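import Summits.CriticalPhenomena.PercolationContinuityZ3.Theorems.PercNearOneGluingNoHeavyLowerTailSahiQuantitativeHarris
import Summits.CriticalPhenomena.PercolationContinuityZ3.Theorems.PercNearOneGluingNoHeavyLowerTailQuantitativeK6HarrisFloor
import Mathlib.Data.Set.BoolIndicator
import HarnessLib

/-!
# Quantitative Harris for bond-percolation product measures, and the EXPLICIT level-0 CSH floor
# (`Cov_μ(f,g) ≥ |E|⁻¹ · Σ_e w_e(1−w_e)·E_μ[Δ_e f · Δ_e g]` for `μ = prodBernoulli w`; row M2-R5 complete chain)

Support file (`--supports stmt-CriticalPhenomena-4575`), prover seat `prim-rate-mine-2` (lane prim-rate, constants-miner (c), BENCH rows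
M2-R1 (percolation vocabulary) and M2-R5 (second inequality)).  No definitions, no named facts, no sorries; standard axioms.

`…SahiQuantitativeHarris.lean` proves the lane's quantitative Harris inequality on the Boolean cube `ι → Bool` with Sahi's finite
expectation `ex (prodWeight q)`.  THIS FILE transports it to the tree's percolation vocabulary — the product measure
`prodBernoulli w` on edge configurations `ω : Set ι`, pivotal differences `f(ω ∪ {e}) − f(ω ∖ {e})` — via `Set.boolIndicator`
(`ex_prodWeight_eq_integral`), giving for nonnegative monotone `f, g : Set ι → ℝ`

* `w_e(1−w_e)·∫ Δ_e f·Δ_e g dμ ≤ Cov_μ(f,g)` for every edge `e` (`coinfluence_le_cov_prodBernoulli`), and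
* `Σ_e w_e(1−w_e)·∫ Δ_e f·Δ_e g dμ ≤ |ι|·Cov_μ(f,g)` (`sum_coinfluence_le_card_mul_cov_prodBernoulli`) — the size constant `1/|E|`;

and then the EXPLICIT form of the level-zero conditioned-slack inequality (K6 / paper Lemma 3.8): combining the second bullet with
`CSH.covTransfer_relaySet_edge_harrisFloor` (the (K6) transfer with its Harris term kept),

  `μ(D ∩ {o↔v})·Cov-term(v↔S) + μ(D)·|E|⁻¹·Σ_e w_e(1−w_e)·E[Δ_e g(𝒞_x)·Δ_e 1_U] ≤ μ(D)·Cov-term(o↔S)`,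
  `D = {v ↮ S}`, `U = {o ↔ S} ∪ {o ↔ v}`, `E = Sym2 V`  (`CSH.covTransfer_relaySet_edge_explicitFloor`):

the level-0 CSH margin is bounded below by joint pivotalities with an explicit constant depending only on the number of edges («box
size»), for every nonnegative monotone cluster functional `g`.
[cite: Harris1960, Lemma 4.1 (p. 16)] [cite: VandenbergHaggstromKahn2005, Thm. 1.4 (p. 7)] [cite: Talagrand1996, Thm. 1.1 (p. 244)]
-/

noncomputable section

namespace Summit.CriticalPhenomena.PercolationContinuityZ3.Theorems

open MeasureTheory Set Literature.Probability.LatticeModels Literature.Probability.Percolation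
open Literature.Combinatorics.Sahi2008 (ex)
open Literature.Probability.Percolation.BHK2006 (weight integral_prodBernoulli_eq_sum openEdgeCluster_mono)
open SahiSubsetChord (prodWeight)
open scoped Classical

namespace QuantHarris

section Transfer

variable {ι : Type*} [Fintype ι] [DecidableEq ι]

/-! ### `Set ι` versus `ι → Bool` -/

omit [DecidableEq ι] in
/-- In Boolean coordinates the BHK product weight is the cube product weight. [folklore] -/
theorem prodWeight_boolIndicator (q : ι → ℝ) (ω : Set ι) : prodWeight q ω.boolIndicator = weight q ω := by
  unfold SahiSubsetChord.prodWeight Literature.Probability.Percolation.BHK2006.weight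
  refine Finset.prod_congr rfl fun i _ => ?_
  by_cases h : i ∈ ω
  · rw [if_pos ((Set.mem_iff_boolIndicator ω i).1 h), if_pos h]
  · rw [if_neg (by rw [(Set.notMem_iff_boolIndicator ω i).1 h]; exact Bool.false_ne_true), if_neg h]

omit [Fintype ι] [DecidableEq ι] in
/-- Reading a set back from its Boolean coordinates. [folklore] -/
theorem setOf_boolIndicator (ω : Set ι) : {i | ω.boolIndicator i = true} = ω :=
  Set.ext fun i => (Set.mem_iff_boolIndicator ω i).symm

omit [Fintype ι] [DecidableEq ι] in
/-- `Set.boolIndicator` is a bijection `Set ι → (ι → Bool)`. [folklore] -/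
theorem boolIndicator_bijective : Function.Bijective (Set.boolIndicator : Set ι → ι → Bool) := by
  constructor
  · intro ω ω' h
    rw [← setOf_boolIndicator ω, ← setOf_boolIndicator ω', h]
  · intro x
    refine ⟨{i | x i = true}, funext fun i => ?_⟩
    by_cases h : x i = true
    · rw [h]; exact (Set.mem_iff_boolIndicator _ i).1 h
    · rw [Bool.not_eq_true] at h
      rw [h]; exact (Set.notMem_iff_boolIndicator _ i).1 (by rw [mem_setOf_eq, h]; exact Bool.false_ne_true)

/-- Sahi's cube expectation under the product weight is the `prodBernoulli` integral. [folklore] -/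
theorem ex_prodWeight_eq_integral (w : ι → unitInterval) (K : (ι → Bool) → ℝ) :
    ex (prodWeight (fun i => (w i : ℝ))) K = ∫ ω, K ω.boolIndicator ∂(prodBernoulli w) := by
  rw [integral_prodBernoulli_eq_sum]
  unfold Literature.Combinatorics.Sahi2008.ex
  exact (Fintype.sum_bijective _ boolIndicator_bijective (fun ω => weight (fun i => (w i : ℝ)) ω * K ω.boolIndicator)
    (fun x => prodWeight (fun i => (w i : ℝ)) x * K x) (fun ω => by rw [prodWeight_boolIndicator])).symm

omit [Fintype ι] in
/-- Switching coordinate `j` on: the set becomes `insert j ω`. [folklore] -/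
theorem setOf_update_true (ω : Set ι) (j : ι) : {i | Function.update ω.boolIndicator j true i = true} = insert j ω := by
  ext i
  rw [mem_setOf_eq, Function.update_apply, mem_insert_iff]
  by_cases h : i = j
  · rw [if_pos h]; exact ⟨fun _ => Or.inl h, fun _ => rfl⟩
  · rw [if_neg h, ← Set.mem_iff_boolIndicator]; exact ⟨fun hi => Or.inr hi, fun hi => hi.resolve_left h⟩

omit [Fintype ι] in
/-- Switching coordinate `j` off: the set becomes `ω ∖ {j}`. [folklore] -/
theorem setOf_update_false (ω : Set ι) (j : ι) : {i | Function.update ω.boolIndicator j false i = true} = ω \ {j} := by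
  ext i
  rw [mem_setOf_eq, Function.update_apply, mem_sdiff, mem_singleton_iff]
  by_cases h : i = j
  · rw [if_pos h]; exact ⟨fun h' => absurd h' Bool.false_ne_true, fun h' => absurd h h'.2⟩
  · rw [if_neg h, ← Set.mem_iff_boolIndicator]; exact ⟨fun hi => ⟨hi, h⟩, fun hi => hi.1⟩

omit [Fintype ι] [DecidableEq ι] in
/-- Pulling a set functional back to the cube preserves monotonicity. [folklore] -/
theorem monotone_comp_setOf {f : Set ι → ℝ} (hf : Monotone f) : Monotone (fun x : ι → Bool => f {i | x i = true}) :=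
  fun _ _ hxy => hf fun i (hi : _ = true) => Bool.le_iff_imp.1 (hxy i) hi

/-! ### Quantitative Harris for `prodBernoulli` -/

/-- **One-edge quantitative Harris for the product measure.**  For nonnegative monotone `f, g : Set ι → ℝ` and every coordinate `e`:
`w_e(1−w_e) · ∫ (f(ω ∪ {e}) − f(ω ∖ {e}))(g(ω ∪ {e}) − g(ω ∖ {e})) dμ ≤ ∫ fg dμ − ∫ f dμ · ∫ g dμ`, `μ = prodBernoulli w`.
(Both pivotal differences ignore the state of `e`, so the left side is `w_e(1−w_e)·E[Δ_e f·Δ_e g]`, the joint influence.)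
[cite: Harris1960, Lemma 4.1 (p. 16)] [cite: Talagrand1996, Thm. 1.1 (p. 244)] -/
theorem coinfluence_le_cov_prodBernoulli (w : ι → unitInterval) (e : ι) (f g : Set ι → ℝ)
    (hf0 : ∀ ω, 0 ≤ f ω) (hg0 : ∀ ω, 0 ≤ g ω) (hf : Monotone f) (hg : Monotone g) :
    (w e : ℝ) * (1 - w e) *
        ∫ ω, (f (insert e ω) - f (ω \ {e})) * (g (insert e ω) - g (ω \ {e})) ∂(prodBernoulli w) ≤
      ∫ ω, f ω * g ω ∂(prodBernoulli w) - (∫ ω, f ω ∂(prodBernoulli w)) * ∫ ω, g ω ∂(prodBernoulli w) := by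
  have hq : ∀ i, 0 ≤ (w i : ℝ) ∧ (w i : ℝ) ≤ 1 := fun i => ⟨(w i).2.1, (w i).2.2⟩
  have h := peelSum_le_cov hq [e] (List.nodup_singleton e) (fun x => f {i | x i = true}) (fun x => g {i | x i = true})
    (fun _ => hf0 _) (fun _ => hg0 _) (monotone_comp_setOf hf) (monotone_comp_setOf hg)
  rw [peelSum_cons, peelSum_nil, mul_zero, add_zero, coinfluence, ex_prodWeight_eq_integral, ex_prodWeight_eq_integral,
    ex_prodWeight_eq_integral, ex_prodWeight_eq_integral] at h
  simp only [Pi.mul_apply, pivDiff, setOf_update_true, setOf_update_false, setOf_boolIndicator] at h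
  exact h

/-- **The explicit size constant for the product measure**: `Σ_e w_e(1−w_e)·∫ Δ_e f·Δ_e g dμ ≤ |ι| · Cov_μ(f,g)`, i.e.
`Cov_μ(f,g) ≥ |E|⁻¹ · Σ_e w_e(1−w_e)·E_μ[Δ_e f·Δ_e g]` for nonnegative monotone `f, g` («box size» enters only through `|E|`).
[cite: Harris1960, Lemma 4.1 (p. 16)] [cite: Talagrand1996, Thm. 1.1 (p. 244)] -/
theorem sum_coinfluence_le_card_mul_cov_prodBernoulli (w : ι → unitInterval) (f g : Set ι → ℝ)
    (hf0 : ∀ ω, 0 ≤ f ω) (hg0 : ∀ ω, 0 ≤ g ω) (hf : Monotone f) (hg : Monotone g) :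
    ∑ e, (w e : ℝ) * (1 - w e) *
        ∫ ω, (f (insert e ω) - f (ω \ {e})) * (g (insert e ω) - g (ω \ {e})) ∂(prodBernoulli w) ≤
      (Fintype.card ι : ℝ) *
        (∫ ω, f ω * g ω ∂(prodBernoulli w) - (∫ ω, f ω ∂(prodBernoulli w)) * ∫ ω, g ω ∂(prodBernoulli w)) := by
  calc ∑ e, (w e : ℝ) * (1 - w e) *
        ∫ ω, (f (insert e ω) - f (ω \ {e})) * (g (insert e ω) - g (ω \ {e})) ∂(prodBernoulli w)
      ≤ ∑ _e : ι, (∫ ω, f ω * g ω ∂(prodBernoulli w) - (∫ ω, f ω ∂(prodBernoulli w)) * ∫ ω, g ω ∂(prodBernoulli w)) :=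
        Finset.sum_le_sum fun e _ => coinfluence_le_cov_prodBernoulli w e f g hf0 hg0 hf hg
    _ = (Fintype.card ι : ℝ) *
        (∫ ω, f ω * g ω ∂(prodBernoulli w) - (∫ ω, f ω ∂(prodBernoulli w)) * ∫ ω, g ω ∂(prodBernoulli w)) := by
        rw [Finset.sum_const, nsmul_eq_mul, Finset.card_univ]

end Transfer

end QuantHarris

namespace CSH

variable {V : Type*} [Fintype V]

/-- **The level-0 CSH transfer (K6) with an EXPLICIT floor.**  For `x ∈ S`, `g` monotone and nonnegative on edge sets, `m = ∫ g(𝒞_x)`,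
`D = {v ↮ S}`, `U = {o ↔ S} ∪ {o ↔ v}`, `E = Sym2 V`:
`μ(D ∩ {o↔v})·(∫_{v↔S} g(𝒞_x) − μ(v↔S)·m) + μ(D)·|E|⁻¹·Σ_e w_e(1−w_e)·∫ Δ_e g(𝒞_x)·Δ_e 1_U ≤ μ(D)·(∫_{o↔S} g(𝒞_x) − μ(o↔S)·m)`.
(K6 with its Harris term kept, `covTransfer_relaySet_edge_harrisFloor`, and the term bounded below by the quantitative Harris
inequality `QuantHarris.sum_coinfluence_le_card_mul_cov_prodBernoulli`.)
[cite: VandenbergHaggstromKahn2005, Thm. 1.4 (p. 7)] [cite: Harris1960, Lemma 4.1 (p. 16)] -/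
theorem covTransfer_relaySet_edge_explicitFloor (w : Sym2 V → unitInterval) (S : Finset V) (o v x : V) (hxS : x ∈ S)
    (g : Set (Sym2 V) → ℝ) (hg : Monotone g) (hg0 : ∀ C, 0 ≤ g C) :
    (prodBernoulli w).real ({ω : BondConfig V | ∀ t ∈ S, ¬ (openGraph ω).Reachable v t} ∩ openConn o v) *
          (∫ ω in (⋃ t ∈ S, openConn v t), g (openEdgeCluster ω x) ∂(prodBernoulli w) -
            (prodBernoulli w).real (⋃ t ∈ S, openConn v t) * ∫ ω, g (openEdgeCluster ω x) ∂(prodBernoulli w)) +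
        (prodBernoulli w).real {ω : BondConfig V | ∀ t ∈ S, ¬ (openGraph ω).Reachable v t} *
          ((Fintype.card (Sym2 V) : ℝ)⁻¹ * ∑ e, (w e : ℝ) * (1 - w e) *
            ∫ ω, (g (openEdgeCluster (insert e ω) x) - g (openEdgeCluster (ω \ {e}) x)) *
              (((⋃ t ∈ S, openConn o t) ∪ openConn o v).indicator (1 : BondConfig V → ℝ) (insert e ω) -
                ((⋃ t ∈ S, openConn o t) ∪ openConn o v).indicator (1 : BondConfig V → ℝ) (ω \ {e})) ∂(prodBernoulli w)) ≤
      (prodBernoulli w).real {ω : BondConfig V | ∀ t ∈ S, ¬ (openGraph ω).Reachable v t} *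
        (∫ ω in (⋃ t ∈ S, openConn o t), g (openEdgeCluster ω x) ∂(prodBernoulli w) -
          (prodBernoulli w).real (⋃ t ∈ S, openConn o t) * ∫ ω, g (openEdgeCluster ω x) ∂(prodBernoulli w)) := by
  set μ := prodBernoulli w with hμ
  set U : Set (BondConfig V) := (⋃ t ∈ S, openConn o t) ∪ openConn o v with hU
  set D : Set (BondConfig V) := {ω | ∀ t ∈ S, ¬ (openGraph ω).Reachable v t} with hD
  have hK6 := covTransfer_relaySet_edge_harrisFloor w S o v x hxS g hg
  have hUup : IsUpperSet U :=
    (isUpperSet_iUnion₂ fun t _ => isUpperSet_openConn o t).union (isUpperSet_openConn o v)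
  have hH := QuantHarris.sum_coinfluence_le_card_mul_cov_prodBernoulli w (fun ω => g (openEdgeCluster ω x))
    (U.indicator (1 : BondConfig V → ℝ)) (fun _ => hg0 _) (fun ω => indicator_nonneg (fun _ _ => zero_le_one) ω)
    (fun _ _ h => hg (openEdgeCluster_mono h x)) (KNPreFKG.monotone_indicator_one_of_isUpperSet hUup)
  have hUm : MeasurableSet U := MeasurableSet.of_discrete
  have hprod : (fun ω => g (openEdgeCluster ω x) * U.indicator (1 : BondConfig V → ℝ) ω) =
      U.indicator (fun ω => g (openEdgeCluster ω x)) := by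
    funext ω
    by_cases h : ω ∈ U
    · rw [indicator_of_mem h, indicator_of_mem h, Pi.one_apply, mul_one]
    · rw [indicator_of_notMem h, indicator_of_notMem h, mul_zero]
  have hint : ∫ ω, g (openEdgeCluster ω x) * U.indicator (1 : BondConfig V → ℝ) ω ∂μ = ∫ ω in U, g (openEdgeCluster ω x) ∂μ := by
    rw [show (∫ ω, g (openEdgeCluster ω x) * U.indicator (1 : BondConfig V → ℝ) ω ∂μ) =
      ∫ ω, U.indicator (fun ω => g (openEdgeCluster ω x)) ω ∂μ from congrArg (fun F => ∫ ω, F ω ∂μ) hprod,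
      integral_indicator hUm]
  have hone : ∫ ω, U.indicator (1 : BondConfig V → ℝ) ω ∂μ = μ.real U := integral_indicator_one hUm
  rw [hint, hone] at hH
  have hcard : (0 : ℝ) < Fintype.card (Sym2 V) := Nat.cast_pos.2 (Fintype.card_pos_iff.2 ⟨s(x, x)⟩)
  have hfl := (inv_mul_le_iff₀ hcard).2 hH
  have hDn : 0 ≤ μ.real D := measureReal_nonneg
  have hmul := mul_le_mul_of_nonneg_left hfl hDn
  linarith [hK6, hmul]

end CSH

end Summit.CriticalPhenomena.PercolationContinuityZ3.Theorems

end
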